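import Mathlib.Analysis.SpecialFunctions.Pow.Real
import HarnessLib

/-!
# Helper for `LeeYangFibres.PrimeCellsRelative` (stmt-Parity-14112), line `Sketch`: `stub_cellsArithUp`

Crux `PrimeCellsRelative` of route `LeeYangFibres` (Parity / GeneralizedHardyLittlewood) is the counting
form of the Dickson–Hardy–Littlewood asymptotic for rough prime cells. The up-transfer
`RelativeDimOne ⟹ PrimeCellsRelative` (stub `stub_upTransfer` of the line) runs Green–Tao's sandwich
(sketch proof of Conj. 1.4 after (1.8)) FORWARDS: from the relative von Mangoldt asymptotic
`|S - M| ≤ a (M + X)` (`a = ε₀/16`, `S = ∑ ∏ Λ`, `M = β_∞ ∏_p β_p` of unknown sign, `X = N`), the sandwich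
`(1-a) Tg ≤ S ≤ (1+a)(Tg + Tb + Tc)` (`Tg = log^t N ×` good prime points, `Tb, Tc` small error counts), the
comparison `TC - Tb ≤ Tg ≤ TC + Tb2` with the (log-weighted) cell count `TC` and `MK = κ M`,
`κ ∈ [1-a, 1+a]`, one concludes the cell asymptotic `|TC - MK| ≤ ε (MK + X)` for `16 a ≤ ε`, `16 a ≤ 1`.

This file is that purely real-arithmetic step. It is the mirror image of `cells_arith` of
`Theorems/LeeYangFibresCellsToRelativeDimOneCounts` (there the roles of the relative asymptotic and of the
cell asymptotic are swapped), and the proof has the same shape: the needed products with `ε₀` are supplied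
as explicit `have`s and `linarith` does the rest, with a case distinction on the sign of `M`.

References: B. Green, T. Tao, *Linear equations in primes*, Ann. of Math. 171 (2010), Conj. 1.4 and the
sketch proof after (1.8) [GreenTao2010].
-/

noncomputable section

namespace Summit.Parity.GeneralizedHardyLittlewood.Cruxes.PrimeCellsRelative.Sketch

/-- **Arithmetic heart of the up-transfer.** With `a = ε₀/16`: from the sandwich
`(1-a)·Tg ≤ S ≤ (1+a)(Tg+Tb+Tc)`, the comparison `TC - Tb ≤ Tg ≤ TC + Tb2` of good points with the cell
count, the relative asymptotic `|S - M| ≤ a (M + X)`, `MK = κ M` with `κ ∈ [1-a, 1+a]` (encoded sign-wise)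
and the smallness `Tb + Tc + Tb2 ≤ a X` of the error counts, the cell asymptotic `|TC - MK| ≤ ε (MK + X)`
follows for `16 a ≤ ε`, `16 a ≤ 1` (case distinction on the sign of `M`; for `M < 0` the relative
asymptotic and `S ≥ 0` force `|M| ≤ a X`, whence `MK ≤ 0 ≤ TC` and both are `O(a X)`). Every step is
linear in the displayed monomials once the listed products with `ε₀` are supplied. [folklore] -/
theorem stub_cellsArithUp {ε ε₀ S M X Tg Tb Tc Tb2 TC MK : ℝ}
    (hε₀ : 0 < ε₀) (hε₀1 : ε₀ ≤ 1) (hε₀ε : ε₀ ≤ ε) (hX : 0 < X)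
    (hTg : 0 ≤ Tg) (hTb : 0 ≤ Tb) (hTc : 0 ≤ Tc) (hTb2 : 0 ≤ Tb2) (hTC : 0 ≤ TC)
    (hS1 : (1 - ε₀ / 16) * Tg ≤ S) (hS2 : S ≤ (1 + ε₀ / 16) * (Tg + Tb + Tc))
    (hG1 : TC - Tb ≤ Tg) (hG2 : Tg ≤ TC + Tb2)
    (hSM : |S - M| ≤ ε₀ / 16 * (M + X))
    (hKp : 0 ≤ M → (1 - ε₀ / 16) * M ≤ MK ∧ MK ≤ (1 + ε₀ / 16) * M)
    (hKn : M < 0 → (1 + ε₀ / 16) * M ≤ MK ∧ MK ≤ (1 - ε₀ / 16) * M)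
    (hE : Tb + Tc + Tb2 ≤ ε₀ / 16 * X) :
    |TC - MK| ≤ ε * (MK + X) := by
  obtain ⟨hP1, hP2⟩ := abs_le.mp hSM
  -- products with `ε₀` of the linear hypotheses (linarith treats each monomial as an atom)
  have e1 : ε₀ * ((1 - ε₀ / 16) * Tg) ≤ ε₀ * S := mul_le_mul_of_nonneg_left hS1 hε₀.le
  have e2 : ε₀ * (S - M) ≤ ε₀ * (ε₀ / 16 * (M + X)) := mul_le_mul_of_nonneg_left hP2 hε₀.le
  have e3 : ε₀ * (Tb + Tc + Tb2) ≤ ε₀ * (ε₀ / 16 * X) := mul_le_mul_of_nonneg_left hE hε₀.le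
  have e4 : ε₀ * (ε₀ * X) ≤ 1 * (ε₀ * X) := mul_le_mul_of_nonneg_right hε₀1 (by positivity)
  have e5 : ε₀ * Tg ≤ 1 * Tg := mul_le_mul_of_nonneg_right hε₀1 hTg
  have e6 : ε₀ * X ≤ 1 * X := mul_le_mul_of_nonneg_right hε₀1 hX.le
  have e7 : ε₀ * (ε₀ * Tg) ≤ 1 * (ε₀ * Tg) := mul_le_mul_of_nonneg_right hε₀1 (by positivity)
  have n1 : 0 ≤ ε₀ * Tb := by positivity
  have n2 : 0 ≤ ε₀ * Tc := by positivity
  have n3 : 0 ≤ ε₀ * Tb2 := by positivity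
  have n4 : 0 ≤ ε₀ * Tg := by positivity
  have n5 : 0 ≤ ε₀ * TC := by positivity
  have n6 : 0 ≤ ε₀ * X := by positivity
  have hS0 : 0 ≤ S := by linarith
  rcases le_or_gt 0 M with hM | hM
  · obtain ⟨k1, k2⟩ := hKp hM
    have m1 : ε₀ * MK ≤ ε₀ * ((1 + ε₀ / 16) * M) := mul_le_mul_of_nonneg_left k2 hε₀.le
    have m2 : ε₀ * ((1 - ε₀ / 16) * M) ≤ ε₀ * MK := mul_le_mul_of_nonneg_left k1 hε₀.le
    have m3 : ε₀ * (ε₀ * M) ≤ 1 * (ε₀ * M) :=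
      mul_le_mul_of_nonneg_right hε₀1 (mul_nonneg hε₀.le hM)
    have m4 : ε₀ * M ≤ 1 * M := mul_le_mul_of_nonneg_right hε₀1 hM
    have m5 : 0 ≤ ε₀ * M := mul_nonneg hε₀.le hM
    have hMK0 : 0 ≤ MK := by linarith
    have m6 : ε₀ * (ε₀ * MK) ≤ 1 * (ε₀ * MK) :=
      mul_le_mul_of_nonneg_right hε₀1 (mul_nonneg hε₀.le hMK0)
    have hfin : ε₀ * (MK + X) ≤ ε * (MK + X) := mul_le_mul_of_nonneg_right hε₀ε (by linarith)
    rw [abs_le]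
    constructor
    · linarith
    · linarith
  · obtain ⟨k1, k2⟩ := hKn hM
    have q1 : 1 * M ≤ ε₀ * M := mul_le_mul_of_nonpos_right hε₀1 hM.le
    have q2 : ε₀ * M ≤ 0 := mul_nonpos_of_nonneg_of_nonpos hε₀.le hM.le
    have hMK : MK < 0 := by linarith
    have q3 : ε₀ * MK ≤ 0 := mul_nonpos_of_nonneg_of_nonpos hε₀.le hMK.le
    have q4 : 1 * (ε₀ * M) ≤ ε₀ * (ε₀ * M) := mul_le_mul_of_nonpos_right hε₀1 q2
    have q5 : ε₀ * ((1 + ε₀ / 16) * M) ≤ ε₀ * MK := mul_le_mul_of_nonneg_left k1 hε₀.le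
    -- `0 ≤ S ≤ (1+a) M + a X` and `M < 0` force `-M ≤ a X`
    have hnegM : -M ≤ ε₀ / 16 * X := by linarith
    have q6 : ε₀ * (-M) ≤ ε₀ * (ε₀ / 16 * X) := mul_le_mul_of_nonneg_left hnegM hε₀.le
    have hMX : 0 ≤ MK + X := by linarith
    have hfin : ε₀ * (MK + X) ≤ ε * (MK + X) := mul_le_mul_of_nonneg_right hε₀ε hMX
    rw [abs_of_nonneg (by linarith)]
    linarith

end Summit.Parity.GeneralizedHardyLittlewood.Cruxes.PrimeCellsRelative.Sketch
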